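import Summits.BirchSwinnertonDyer.BirchSwinnertonDyer.Theses.CMKolyvaginAtInertTwo
import Summits.BirchSwinnertonDyer.BirchSwinnertonDyer.Theorems.CMKolyvaginAtInertTwoExactSumDefectLeOneAtTwo
import HarnessLib

/-!
# Route `CMKolyvaginAtInertTwo`: the `…OfFacts` twin of the ONE-BIT EXACTNESS item, BY NAME

Seat `bsd-line-cmk2-p1` g22 (cell `bsd-print-cf2`).  Closes item stmt-BirchSwinnertonDyer-28667
`CMKolyvaginExactAtInertTwoOneBitRestatedOfFacts` (route rev 19/20, pen bsd-idea-1 g23 = restatement R1′ of g20/g21's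
`Cruxes/CMExactDescentAtTwo/RESTATE-24277.md` v2): (Gross–Zagier at every level ∧ GZK ∧ entire `L`-function ∧ Milne any-model) ∧
`Prop37ReductionCongruenceInertAll` ⟹ `CMKolyvaginExactAtInertTwoOneBitRestated` (crux 24277 VERBATIM + «Σ_E(d_K) ≤ 1»:
`#Ш(E_K)[2^∞] = 2^{2M₀}` on the one-bit sub-habitat).  The closer is ONE LINE: g21's
`KolyvaginLowerTwo.cmKolyvaginExactAtInertTwo_of_sum_defect_le_one_of_printedInputs` (p758017; upper half g18
`KolyvaginPairSupplyTwo.card_primaryComponent_sha_two_baseChange_le_pow_of_sum_defect_le_one`, lower half by the level-`2` W-UP engine with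
one genus place, null places p756644) with the binders permuted — the kernel-checked `TURNKEY_closes_24277_onebit.lean` of the crux directory.

HONEST FRAMING: the item is an implication FROM five statement-only prints (four BSD-side + Gross 1991 Prop. 3.7 (2)); the theorem below
discharges the implication, not the prints.  BSD is NOT proved by this; the leaf `WAllCornerFTwo` is NOT closed by this (the route's `closes`
still consumes Kolyvagin's conjecture at `2` (24648), the silent Heegner twin supply HL′ (28663) and the residual 22838).

References: [McCallumLMS1991] §5 Thm. 5.4; [Kolyvagin1991MathAnn] Thm. 2.2; [GrossLMS1991] Prop. 3.7 (2); [Kramer1981] Prop. 3;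
[GrossZagier1986]; [Milne1972ArithmeticAV] Thm. 1.
-/

set_option autoImplicit false
-- the Theorems namespace of this sub repeats the summit name by design (D-0017 nested layout)
set_option linter.dupNamespace false

namespace Summit.BirchSwinnertonDyer.BirchSwinnertonDyer.Theorems

/-- **Item 28667 `CMKolyvaginExactAtInertTwoOneBitRestatedOfFacts`, BY NAME**: the four BSD-side prints and Gross 1991 Prop. 3.7 (2)
(for every `(W, K)`) imply Kolyvagin–McCallum exactness `#Ш(E_K)[2^∞] = 2^{2M₀}` at the inert prime `2` on H₂ for every Heegner field of
one-bit genus defect — g21's `KolyvaginLowerTwo.cmKolyvaginExactAtInertTwo_of_sum_defect_le_one_of_printedInputs` with its binders permuted.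
BSD is NOT proved by this. [cite: McCallumLMS1991, §5 Thm. 5.4] [cite: GrossLMS1991, Prop. 3.7 (2)] [cite: Kramer1981, Prop. 3] -/
theorem cmKolyvaginExactAtInertTwoOneBitRestatedOfFacts_proof :
    Summit.BirchSwinnertonDyer.BirchSwinnertonDyer.Theses.CMKolyvaginAtInertTwo.CMKolyvaginExactAtInertTwoOneBitRestatedOfFacts := by
  rintro ⟨⟨hGZ, hGZK, hmod, hMi⟩, h37⟩ W _ _ _ hCM hin hρ hT K _ _ hK hodd h3 hH hdef hs1 hs2 Dt β ι d₁ hy M₀ hdiv hndiv n d hn hKoly hPn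
  exact KolyvaginLowerTwo.cmKolyvaginExactAtInertTwo_of_sum_defect_le_one_of_printedInputs W hCM hin hρ hT K hK hodd h3 hH hs1 hs2 Dt β ι
    d₁ hy M₀ hdiv hndiv n d hn hKoly hPn hdef (h37 W K) hGZ hGZK hmod hMi

end Summit.BirchSwinnertonDyer.BirchSwinnertonDyer.Theorems
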